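import Literature.MathematicalPhysics.QuantumLattice.HubbardChainEnergyDensityAt
import HarnessLib

/-!
# Convexity of the ground-state energy density of the Hubbard chain in the filling

Topic `MathematicalPhysics/QuantumLattice` (family `hubbard`); namespace
`Literature.MathematicalPhysics.QuantumLattice.ThermodynamicLimit`. Companion of
`HubbardChainEnergyDensityAt.lean`, which names the thermodynamic limit
`e(p/q) = hubbardChainEnergyDensityAt t U p q = lim_m E_{qm}(pm)/(qm)` of the ground-state energy per
site of the Hubbard ring at the rational filling `p/q ∈ [0, 2]` (`U ≥ 0`). Here we prove that this
energy density is a CONVEX function of the filling — the `d = 1` twin of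
`convexOn_energyDensity2D` (`HubbardTorus2DEnergyDensityConvex.lean`), stated at rational fillings
(the chain object is only named there):

* `hubbardChainEnergyDensityAt_three_point` — for `0 ≤ a < b < c ≤ 2q`:
  `(c - a)·e(b/q) ≤ (c - b)·e(a/q) + (b - a)·e(c/q)`. Proof: glue `c - b` rings of `qm` sites with
  `am` electrons and `b - a` rings of `qm` sites with `cm` electrons into ONE ring of `(c - a)qm` sites
  (the ring cut `groundEnergyAt_ring_le_add`, `8|t|` a joint); it carries `(c - a)bm` electrons, i.e.
  filling `b/q`; divide by `qm` and let `m → ∞` (`tendsto_hubbardChainEnergyDensityAt`).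
* `hubbardChainEnergyDensityAt_slope_mono` — the same for three arbitrary rational fillings
  `p₁/q₁ < p₂/q₂ < p₃/q₃ ≤ 2` (common denominator; `hubbardChainEnergyDensityAt_mul`): secant slopes
  increase.
* `exists_supporting_line_hubbardChainEnergyDensityAt` — at every interior rational filling
  `0 < p/q < 2` there is a slope `s` with `e(p/q) + s·(p'/q' - p/q) ≤ e(p'/q')` for ALL rational
  fillings `p'/q' ∈ [0, 2]` (`s` = the supremum of the left secant slopes). This is the input of the
  infinite-volume variational principle for the chain (`HubbardChainEnergyDensityVariationalPrinciple`).

Ruelle (1969) §3.3 proves existence AND convexity of the limiting energy/free-energy densities by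
exactly this block-gluing argument; Lieb–Wu (2003) §7 use "`E(N) = N_a e(N/N_a)` and `e` is a convex
function" for the chain. Everything is PROVED; no definition, no named fact.

## References

* D. Ruelle, *Statistical Mechanics: Rigorous Results* (Benjamin, 1969), §3.3–§3.4.
  [cite: Ruelle1969, §3.3]
* E. H. Lieb, F. Y. Wu, Physica A 321 (2003) 1–27, §7. [cite: LiebWuPhysicaA2003, §7]
-/

noncomputable section

open Filter Topology Finset
open scoped BigOperators

namespace Literature.MathematicalPhysics.QuantumLattice

namespace ThermodynamicLimit

/-! ### Gluing rings -/

/-- Transport of ring ground energies along an equality of ring lengths (the vertex type depends on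
the length); private plumbing. [folklore] -/
private theorem groundEnergyAt_ring_lengthCongr (t U : ℝ) {L₁ L₂ : ℕ} (h : L₁ = L₂) (N : ℕ) :
    groundEnergyAt (fermionTorusGraph 1 L₁) t U N = groundEnergyAt (fermionTorusGraph 1 L₂) t U N := by
  subst h
  rfl

/-- **Stacking `k` copies of a ring**: `E_{kL}(kA) ≤ k·E_L(A) + 8|t|·k` for `k ≥ 1`, `A ≤ 2L`
(`k - 1` ring cuts of `8|t|` each, `groundEnergyAt_ring_le_add`; the bound is weakened to `k` joints).
[cite: Ruelle1969, §3.3] -/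
theorem groundEnergyAt_ring_stack_le (L : ℕ) (t U : ℝ) {A : ℕ} (hA : A ≤ 2 * L) :
    ∀ k : ℕ, 1 ≤ k →
      groundEnergyAt (fermionTorusGraph 1 (k * L)) t U (k * A) ≤
        k * groundEnergyAt (fermionTorusGraph 1 L) t U A + 8 * |t| * k := by
  intro k hk
  induction k, hk using Nat.le_induction with
  | base =>
    rw [groundEnergyAt_ring_lengthCongr t U (one_mul L), one_mul]
    push_cast
    linarith [abs_nonneg t]
  | succ k hkpos ih =>
    have hcut := groundEnergyAt_ring_le_add (k * L) L t U (N₁ := k * A) (N₂ := A) (by nlinarith) hA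
    rw [groundEnergyAt_ring_lengthCongr t U (show k * L + L = (k + 1) * L by ring),
      show k * A + A = (k + 1) * A by ring] at hcut
    push_cast
    linarith

/-- **Gluing rings of two fillings**: for `i, j ≥ 1` and `A, C ≤ 2L`,
`E_{(i+j)L}(iA + jC) ≤ i·E_L(A) + j·E_L(C) + 8|t|·(i + j + 1)`. [cite: Ruelle1969, §3.3] -/
theorem groundEnergyAt_ring_glue_le (L : ℕ) (t U : ℝ) {A C : ℕ} (hA : A ≤ 2 * L) (hC : C ≤ 2 * L)
    {i j : ℕ} (hi : 1 ≤ i) (hj : 1 ≤ j) :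
    groundEnergyAt (fermionTorusGraph 1 ((i + j) * L)) t U (i * A + j * C) ≤
      i * groundEnergyAt (fermionTorusGraph 1 L) t U A + j * groundEnergyAt (fermionTorusGraph 1 L) t U C +
        8 * |t| * (i + j + 1) := by
  have h₁ := groundEnergyAt_ring_stack_le L t U hA i hi
  have h₂ := groundEnergyAt_ring_stack_le L t U hC j hj
  have hcut := groundEnergyAt_ring_le_add (i * L) (j * L) t U (N₁ := i * A) (N₂ := j * C)
    (by nlinarith) (by nlinarith)
  rw [groundEnergyAt_ring_lengthCongr t U (show i * L + j * L = (i + j) * L by ring)] at hcut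
  linarith

/-! ### Three-point convexity at a common denominator -/

/-- **Convexity of the chain energy density in the filling (three-point form, common denominator).**
For `U ≥ 0`, `q ≥ 1` and natural numbers `a < b < c ≤ 2q`:
`(c - a)·e(b/q) ≤ (c - b)·e(a/q) + (b - a)·e(c/q)`, `e(p/q) = hubbardChainEnergyDensityAt t U p q`.
(Glue `c - b` rings at filling `a/q` and `b - a` rings at filling `c/q`, all of `qm` sites, into one
ring of `(c-a)qm` sites and `(c-a)bm` electrons; divide by `qm`; `m → ∞`.) Ruelle (1969) §3.3;
Lieb–Wu (2003) §7 ("`e` is a convex function"). [cite: Ruelle1969, §3.3] -/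
theorem hubbardChainEnergyDensityAt_three_point (t : ℝ) {U : ℝ} (hU : 0 ≤ U) {q a b c : ℕ}
    (hq : 1 ≤ q) (hab : a < b) (hbc : b < c) (hc : c ≤ 2 * q) :
    ((c : ℝ) - a) * hubbardChainEnergyDensityAt t U b q ≤
      ((c : ℝ) - b) * hubbardChainEnergyDensityAt t U a q +
        ((b : ℝ) - a) * hubbardChainEnergyDensityAt t U c q := by
  obtain ⟨j, rfl⟩ : ∃ j, b = a + j := ⟨b - a, by omega⟩
  obtain ⟨i, rfl⟩ : ∃ i, c = a + j + i := ⟨c - (a + j), by omega⟩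
  have hi : 1 ≤ i := by omega
  have hj : 1 ≤ j := by omega
  have ha2 : a ≤ 2 * q := by omega
  have hb2 : a + j ≤ 2 * q := by omega
  push_cast
  simp only [add_sub_cancel_left, show ((a : ℝ) + j + i - a) = i + j by ring]
  -- abbreviations
  set E : ℕ → ℕ → ℝ := fun L N => groundEnergyAt (fermionTorusGraph 1 L) t U N with hE
  set ea := hubbardChainEnergyDensityAt t U a q
  set eb := hubbardChainEnergyDensityAt t U (a + j) q
  set ec := hubbardChainEnergyDensityAt t U (a + j + i) q
  -- the three defining limits
  have hla : Tendsto (fun m : ℕ => E (q * m) (a * m) / ((q * m : ℕ) : ℝ)) atTop (𝓝 ea) :=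
    tendsto_hubbardChainEnergyDensityAt t hU hq ha2
  have hlc : Tendsto (fun m : ℕ => E (q * m) ((a + j + i) * m) / ((q * m : ℕ) : ℝ)) atTop (𝓝 ec) :=
    tendsto_hubbardChainEnergyDensityAt t hU hq hc
  have hk : 1 ≤ i + j := by omega
  have hlb : Tendsto (fun m : ℕ => E ((i + j) * q * m) ((i + j) * (a + j) * m) / (((i + j) * q * m : ℕ) : ℝ))
      atTop (𝓝 eb) := by
    have h := tendsto_hubbardChainEnergyDensityAt t hU (p := (i + j) * (a + j)) (q := (i + j) * q)
      (by nlinarith) (by nlinarith)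
    rwa [hubbardChainEnergyDensityAt_mul t hU hq hb2 hk] at h
  have hzero : Tendsto (fun m : ℕ => 8 * |t| * ((i : ℝ) + j + 1) / ((q * m : ℕ) : ℝ)) atTop (𝓝 0) := by
    have h1 : Tendsto (fun m : ℕ => ((q * m : ℕ) : ℝ)) atTop atTop := by
      refine tendsto_natCast_atTop_atTop.comp ?_
      exact tendsto_atTop_mono (fun m => Nat.le_mul_of_pos_left m (by omega)) tendsto_id
    exact tendsto_const_nhds.div_atTop h1
  -- the glued inequality at every `m ≥ 1`, divided by `qm`
  have hineq : ∀ᶠ m : ℕ in atTop,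
      ((i : ℝ) + j) * (E ((i + j) * q * m) ((i + j) * (a + j) * m) / (((i + j) * q * m : ℕ) : ℝ)) ≤
        (i : ℝ) * (E (q * m) (a * m) / ((q * m : ℕ) : ℝ)) + (j : ℝ) * (E (q * m) ((a + j + i) * m) / ((q * m : ℕ) : ℝ)) +
          8 * |t| * ((i : ℝ) + j + 1) / ((q * m : ℕ) : ℝ) := by
    filter_upwards [eventually_ge_atTop 1] with m hm
    have hqm : (0 : ℝ) < ((q * m : ℕ) : ℝ) := by
      have : 0 < q * m := Nat.mul_pos (by omega) (by omega)
      exact_mod_cast this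
    have hglue := groundEnergyAt_ring_glue_le (q * m) t U (A := a * m) (C := (a + j + i) * m)
      (by nlinarith) (by nlinarith) hi hj
    -- lengths and particle numbers of the glued ring
    have hlen : (i + j) * (q * m) = (i + j) * q * m := by ring
    have hpart : i * (a * m) + j * ((a + j + i) * m) = (i + j) * (a + j) * m := by ring
    rw [groundEnergyAt_ring_lengthCongr t U hlen, hpart] at hglue
    -- `E_big/(qm) = (i+j) · E_big/((i+j)qm)`
    have hbig : ((i : ℝ) + j) * (E ((i + j) * q * m) ((i + j) * (a + j) * m) / (((i + j) * q * m : ℕ) : ℝ)) =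
        E ((i + j) * q * m) ((i + j) * (a + j) * m) / ((q * m : ℕ) : ℝ) := by
      have hk0 : ((i : ℝ) + j) ≠ 0 := by positivity
      rw [show (((i + j) * q * m : ℕ) : ℝ) = ((i : ℝ) + j) * ((q * m : ℕ) : ℝ) by push_cast; ring]
      field_simp
    rw [hbig, mul_div_assoc', mul_div_assoc', ← add_div, ← add_div, div_le_div_iff_of_pos_right hqm]
    simp only [hE] at hglue ⊢
    linarith
  -- pass to the limit
  have hlim₁ : Tendsto (fun m : ℕ => ((i : ℝ) + j) *
      (E ((i + j) * q * m) ((i + j) * (a + j) * m) / (((i + j) * q * m : ℕ) : ℝ))) atTop (𝓝 (((i : ℝ) + j) * eb)) :=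
    hlb.const_mul _
  have hlim₂ : Tendsto (fun m : ℕ => (i : ℝ) * (E (q * m) (a * m) / ((q * m : ℕ) : ℝ)) +
      (j : ℝ) * (E (q * m) ((a + j + i) * m) / ((q * m : ℕ) : ℝ)) + 8 * |t| * ((i : ℝ) + j + 1) / ((q * m : ℕ) : ℝ))
      atTop (𝓝 ((i : ℝ) * ea + (j : ℝ) * ec + 0)) :=
    ((hla.const_mul _).add (hlc.const_mul _)).add hzero
  have h := le_of_tendsto_of_tendsto hlim₁ hlim₂ hineq
  linarith

/-! ### Fillings as rationals: the value depends on `p/q` only, and secant slopes increase -/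

/-- The energy density depends on the ratio only: `p₁ q₂ = p₂ q₁` gives `e(p₁/q₁) = e(p₂/q₂)`.
[cite: Ruelle1969, §2.2] -/
theorem hubbardChainEnergyDensityAt_eq_of_cross_mul_eq (t : ℝ) {U : ℝ} (hU : 0 ≤ U) {p₁ q₁ p₂ q₂ : ℕ}
    (hq₁ : 1 ≤ q₁) (hq₂ : 1 ≤ q₂) (hp₁ : p₁ ≤ 2 * q₁) (hp₂ : p₂ ≤ 2 * q₂) (h : p₁ * q₂ = p₂ * q₁) :
    hubbardChainEnergyDensityAt t U p₁ q₁ = hubbardChainEnergyDensityAt t U p₂ q₂ := by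
  rw [← hubbardChainEnergyDensityAt_mul t hU hq₁ hp₁ hq₂, ← hubbardChainEnergyDensityAt_mul t hU hq₂ hp₂ hq₁,
    show q₂ * p₁ = q₁ * p₂ by rw [mul_comm q₂, h, mul_comm], mul_comm q₂ q₁]

/-- **Secant slopes of the chain energy density increase** (three-point convexity for arbitrary
rational fillings): for `U ≥ 0` and rational fillings `p₁/q₁ < p₂/q₂ < p₃/q₃ ≤ 2`,
`(x₃ - x₁)·e(x₂) ≤ (x₃ - x₂)·e(x₁) + (x₂ - x₁)·e(x₃)` with `x_k = p_k/q_k`. (Common denominator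
`q₁q₂q₃` and `hubbardChainEnergyDensityAt_three_point`.) [cite: Ruelle1969, §3.3] -/
theorem hubbardChainEnergyDensityAt_three_point_rat (t : ℝ) {U : ℝ} (hU : 0 ≤ U) {p₁ q₁ p₂ q₂ p₃ q₃ : ℕ}
    (hq₁ : 1 ≤ q₁) (hq₂ : 1 ≤ q₂) (hq₃ : 1 ≤ q₃) (hp₃ : p₃ ≤ 2 * q₃)
    (h₁₂ : p₁ * q₂ < p₂ * q₁) (h₂₃ : p₂ * q₃ < p₃ * q₂) :
    ((p₃ : ℝ) / q₃ - (p₁ : ℝ) / q₁) * hubbardChainEnergyDensityAt t U p₂ q₂ ≤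
      ((p₃ : ℝ) / q₃ - (p₂ : ℝ) / q₂) * hubbardChainEnergyDensityAt t U p₁ q₁ +
        ((p₂ : ℝ) / q₂ - (p₁ : ℝ) / q₁) * hubbardChainEnergyDensityAt t U p₃ q₃ := by
  -- common denominator `Q = q₁ q₂ q₃`
  set Q : ℕ := q₁ * q₂ * q₃ with hQ
  set a : ℕ := p₁ * (q₂ * q₃) with ha
  set b : ℕ := p₂ * (q₁ * q₃) with hb
  set c : ℕ := p₃ * (q₁ * q₂) with hc
  have hQ1 : 1 ≤ Q := by simp only [hQ]; exact Nat.mul_pos (Nat.mul_pos hq₁ hq₂) hq₃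
  have hab : a < b := by
    simp only [ha, hb]
    have := Nat.mul_lt_mul_of_lt_of_le h₁₂ (le_refl q₃) (by omega)
    nlinarith
  have hbc : b < c := by
    simp only [hb, hc]
    have := Nat.mul_lt_mul_of_lt_of_le h₂₃ (le_refl q₁) (by omega)
    nlinarith
  have hc2 : c ≤ 2 * Q := by simp only [hc, hQ]; nlinarith
  -- `p₂ ≤ 2 q₂`, `p₁ ≤ 2 q₁` follow
  have hp₂ : p₂ ≤ 2 * q₂ := by
    by_contra hcon
    push Not at hcon
    have : p₃ * q₂ ≤ 2 * q₃ * q₂ := Nat.mul_le_mul_right _ hp₃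
    nlinarith
  have hp₁ : p₁ ≤ 2 * q₁ := by
    by_contra hcon
    push Not at hcon
    have : p₂ * q₁ ≤ 2 * q₂ * q₁ := Nat.mul_le_mul_right _ hp₂
    nlinarith
  have h3 := hubbardChainEnergyDensityAt_three_point t hU hQ1 hab hbc hc2
  -- identify the three densities
  have hea : hubbardChainEnergyDensityAt t U a Q = hubbardChainEnergyDensityAt t U p₁ q₁ := by
    rw [show a = (q₂ * q₃) * p₁ by simp only [ha]; ring, show Q = (q₂ * q₃) * q₁ by simp only [hQ]; ring]
    exact hubbardChainEnergyDensityAt_mul t hU hq₁ hp₁ (Nat.mul_pos hq₂ hq₃)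
  have heb : hubbardChainEnergyDensityAt t U b Q = hubbardChainEnergyDensityAt t U p₂ q₂ := by
    rw [show b = (q₁ * q₃) * p₂ by simp only [hb]; ring, show Q = (q₁ * q₃) * q₂ by simp only [hQ]; ring]
    exact hubbardChainEnergyDensityAt_mul t hU hq₂ hp₂ (Nat.mul_pos hq₁ hq₃)
  have hec : hubbardChainEnergyDensityAt t U c Q = hubbardChainEnergyDensityAt t U p₃ q₃ := by
    rw [show c = (q₁ * q₂) * p₃ by simp only [hc]; ring, show Q = (q₁ * q₂) * q₃ from hQ]
    exact hubbardChainEnergyDensityAt_mul t hU hq₃ hp₃ (Nat.mul_pos hq₁ hq₂)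
  rw [hea, heb, hec] at h3
  -- divide by `Q`
  have hQpos : (0 : ℝ) < Q := by exact_mod_cast hQ1
  have hq₁r : (0 : ℝ) < q₁ := by exact_mod_cast hq₁
  have hq₂r : (0 : ℝ) < q₂ := by exact_mod_cast hq₂
  have hq₃r : (0 : ℝ) < q₃ := by exact_mod_cast hq₃
  have hx₁ : (p₁ : ℝ) / q₁ = (a : ℝ) / Q := by
    rw [div_eq_div_iff hq₁r.ne' hQpos.ne']
    exact_mod_cast (show p₁ * Q = a * q₁ by simp only [ha, hQ]; ring)
  have hx₂ : (p₂ : ℝ) / q₂ = (b : ℝ) / Q := by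
    rw [div_eq_div_iff hq₂r.ne' hQpos.ne']
    exact_mod_cast (show p₂ * Q = b * q₂ by simp only [hb, hQ]; ring)
  have hx₃ : (p₃ : ℝ) / q₃ = (c : ℝ) / Q := by
    rw [div_eq_div_iff hq₃r.ne' hQpos.ne']
    exact_mod_cast (show p₃ * Q = c * q₃ by simp only [hc, hQ]; ring)
  rw [hx₁, hx₂, hx₃, ← sub_div, ← sub_div, ← sub_div, div_mul_eq_mul_div, div_mul_eq_mul_div,
    div_mul_eq_mul_div, ← add_div, div_le_div_iff_of_pos_right hQpos]
  exact h3

/-- **Monotone secant slopes**: for rational fillings `x₁ < x₂ < x₃ ≤ 2` (`x_k = p_k/q_k`, `U ≥ 0`),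
`(e(x₂) - e(x₁))/(x₂ - x₁) ≤ (e(x₃) - e(x₂))/(x₃ - x₂)`. [cite: Ruelle1969, §3.3] -/
theorem hubbardChainEnergyDensityAt_slope_mono (t : ℝ) {U : ℝ} (hU : 0 ≤ U) {p₁ q₁ p₂ q₂ p₃ q₃ : ℕ}
    (hq₁ : 1 ≤ q₁) (hq₂ : 1 ≤ q₂) (hq₃ : 1 ≤ q₃) (hp₃ : p₃ ≤ 2 * q₃)
    (h₁₂ : p₁ * q₂ < p₂ * q₁) (h₂₃ : p₂ * q₃ < p₃ * q₂) :
    (hubbardChainEnergyDensityAt t U p₂ q₂ - hubbardChainEnergyDensityAt t U p₁ q₁) /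
        ((p₂ : ℝ) / q₂ - (p₁ : ℝ) / q₁) ≤
      (hubbardChainEnergyDensityAt t U p₃ q₃ - hubbardChainEnergyDensityAt t U p₂ q₂) /
        ((p₃ : ℝ) / q₃ - (p₂ : ℝ) / q₂) := by
  have h3 := hubbardChainEnergyDensityAt_three_point_rat t hU hq₁ hq₂ hq₃ hp₃ h₁₂ h₂₃
  have hq₁r : (0 : ℝ) < q₁ := by exact_mod_cast hq₁
  have hq₂r : (0 : ℝ) < q₂ := by exact_mod_cast hq₂
  have hq₃r : (0 : ℝ) < q₃ := by exact_mod_cast hq₃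
  have hd₁₂ : (0 : ℝ) < (p₂ : ℝ) / q₂ - (p₁ : ℝ) / q₁ := by
    rw [sub_pos, div_lt_div_iff₀ hq₁r hq₂r]
    exact_mod_cast h₁₂
  have hd₂₃ : (0 : ℝ) < (p₃ : ℝ) / q₃ - (p₂ : ℝ) / q₂ := by
    rw [sub_pos, div_lt_div_iff₀ hq₂r hq₃r]
    exact_mod_cast h₂₃
  rw [div_le_div_iff₀ hd₁₂ hd₂₃]
  nlinarith

/-! ### The supporting line at an interior rational filling -/

/-- **Supporting line of the convex chain energy density.** For `U ≥ 0` and every interior rational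
filling `0 < p/q < 2` there is a slope `s ∈ ℝ` such that
`e(p/q) + s·(p'/q' - p/q) ≤ e(p'/q')` for every rational filling `p'/q' ∈ [0, 2]`
(`s` = the supremum of the secant slopes from the left, finite by the monotonicity of secant slopes).
Ruelle (1969) §3.4 (convexity of the energy density; tangent functionals).
[cite: Ruelle1969, §3.4] -/
theorem exists_supporting_line_hubbardChainEnergyDensityAt (t : ℝ) {U : ℝ} (hU : 0 ≤ U) {p q : ℕ}
    (hq : 1 ≤ q) (hp0 : 0 < p) (hp : p < 2 * q) :
    ∃ s : ℝ, ∀ p' q' : ℕ, 1 ≤ q' → p' ≤ 2 * q' →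
      hubbardChainEnergyDensityAt t U p q + s * ((p' : ℝ) / q' - (p : ℝ) / q) ≤
        hubbardChainEnergyDensityAt t U p' q' := by
  set e₀ := hubbardChainEnergyDensityAt t U p q with he₀
  set x₀ : ℝ := (p : ℝ) / q with hx₀
  have hqr : (0 : ℝ) < q := by exact_mod_cast hq
  -- the left secant slopes
  set S : Set ℝ := {σ | ∃ p' q' : ℕ, 1 ≤ q' ∧ p' * q < p * q' ∧
    σ = (e₀ - hubbardChainEnergyDensityAt t U p' q') / (x₀ - (p' : ℝ) / q')} with hS
  have hSne : S.Nonempty :=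
    ⟨_, 0, 1, le_rfl, by simpa using hp0, rfl⟩
  -- every left slope is below the right slope to the filled band `2 = 2/1`
  set R : ℝ := (hubbardChainEnergyDensityAt t U 2 1 - e₀) / ((2 : ℕ) / ((1 : ℕ) : ℝ) - x₀) with hR
  have hp2 : p * 1 < 2 * q := by omega
  have hleft : ∀ σ ∈ S, σ ≤ R := by
    rintro σ ⟨p', q', hq', hlt, rfl⟩
    have h := hubbardChainEnergyDensityAt_slope_mono t hU hq' hq (le_refl 1) (by norm_num) hlt hp2
    have hq'r : (0 : ℝ) < q' := by exact_mod_cast hq'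
    have hd : (0 : ℝ) < x₀ - (p' : ℝ) / q' := by
      rw [hx₀, sub_pos, div_lt_div_iff₀ hq'r hqr]
      exact_mod_cast hlt
    rw [show (e₀ - hubbardChainEnergyDensityAt t U p' q') / (x₀ - (p' : ℝ) / q') =
      (hubbardChainEnergyDensityAt t U p q - hubbardChainEnergyDensityAt t U p' q') / ((p : ℝ) / q - (p' : ℝ) / q')
      by rfl]
    exact h
  have hSbdd : BddAbove S := ⟨R, hleft⟩
  refine ⟨sSup S, fun p' q' hq' hp' => ?_⟩
  have hq'r : (0 : ℝ) < q' := by exact_mod_cast hq'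
  rcases lt_trichotomy (p' * q) (p * q') with hlt | heq | hgt
  · -- left of `x₀`: the slope to `p'/q'` is in `S`
    have hmem : (e₀ - hubbardChainEnergyDensityAt t U p' q') / (x₀ - (p' : ℝ) / q') ∈ S :=
      ⟨p', q', hq', hlt, rfl⟩
    have hle := le_csSup hSbdd hmem
    have hd : (0 : ℝ) < x₀ - (p' : ℝ) / q' := by
      rw [hx₀, sub_pos, div_lt_div_iff₀ hq'r hqr]
      exact_mod_cast hlt
    rw [div_le_iff₀ hd] at hle
    nlinarith
  · -- the same filling
    have hsame : hubbardChainEnergyDensityAt t U p' q' = e₀ :=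
      hubbardChainEnergyDensityAt_eq_of_cross_mul_eq t hU hq' hq hp' (by omega) heq
    have hx : (p' : ℝ) / q' - x₀ = 0 := by
      rw [hx₀, sub_eq_zero, div_eq_div_iff hq'r.ne' hqr.ne']
      exact_mod_cast heq
    rw [hsame, hx, mul_zero, add_zero]
  · -- right of `x₀`: every left slope is below the slope to `p'/q'`
    have hd : (0 : ℝ) < (p' : ℝ) / q' - x₀ := by
      rw [hx₀, sub_pos, div_lt_div_iff₀ hqr hq'r]
      exact_mod_cast hgt
    have hle : sSup S ≤ (hubbardChainEnergyDensityAt t U p' q' - e₀) / ((p' : ℝ) / q' - x₀) := by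
      refine csSup_le hSne ?_
      rintro σ ⟨p'', q'', hq'', hlt, rfl⟩
      exact hubbardChainEnergyDensityAt_slope_mono t hU hq'' hq hq' hp' hlt hgt
    rw [le_div_iff₀ hd] at hle
    linarith

/-- **Midpoint convexity** (the special case `b = a + 1`, `c = a + 2`):
`2·e((a+1)/q) ≤ e(a/q) + e((a+2)/q)` for `a + 2 ≤ 2q`, `q ≥ 1`, `U ≥ 0`. [cite: LiebWuPhysicaA2003, §7] -/
theorem hubbardChainEnergyDensityAt_midpoint (t : ℝ) {U : ℝ} (hU : 0 ≤ U) {q a : ℕ} (hq : 1 ≤ q)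
    (ha : a + 2 ≤ 2 * q) :
    2 * hubbardChainEnergyDensityAt t U (a + 1) q ≤
      hubbardChainEnergyDensityAt t U a q + hubbardChainEnergyDensityAt t U (a + 2) q := by
  have h := hubbardChainEnergyDensityAt_three_point t hU hq (Nat.lt_succ_self a) (Nat.lt_succ_self (a + 1)) ha
  push_cast at h
  linarith

end ThermodynamicLimit

end Literature.MathematicalPhysics.QuantumLattice

end
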